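/- Copyright: ym3-torus cell, WIDTH seat `ym-ust-19936-w7` (prover, g9), for crux `HistoryTailL` (stmt-QuantumFields-19936),
level-0 infrastructure (T4-LOW, part 3) of LINE `local_insertion` (#13) ∕ K1.  Released under the licence of the surrounding project. -/
import Summits.QuantumFields.YangMills.Theorems.LocalInsertionTorusTreeGaugePushforward
import Summits.QuantumFields.YangMills.Theorems.LocalInsertionTorusTreeGaugeGaussian
import Summits.QuantumFields.YangMills.Theorems.LocalInsertionTorusHyperplaneTwist
import HarnessLib

/-!
# The holonomy-conditioned Gaussian lower bound of the torus partition function (every `d`)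

Support file (`--supports stmt-QuantumFields-19936 --as helper`), third brick of «(T4) UNIFORM DOUBLING, general d» = (T4-LOW)
(LEAD ★w1-19936 g7 00:35:51Z (2) GO, 00:47:49Z «(T4) is on the critical path: K1's γ-free constants need the γ-uniform (EM)»); general-`d`
port of ✓`…LangevinControlUVFemtoCurvatureTwoPointCTorusLowerAxis` (`torus_lower_axisHolonomy`, route `LangevinControlUV`, `d = 4`).

★ `lintegral_boltzmann_ge_axisHolonomy`: on the torus `(ℤ/Lℤ)^d` (`L ≥ 2`, `d ≥ 1`), for a compact second countable `G`, a continuous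
unitary `ρ` on `ℂ^N`, `b ≥ 0`, `δ ≥ 0`:

  `∫ e^{−bS} dπ ≥ e^{−16Nbδ²·#plaquettes} · Haar{‖ρ g − 1‖ ≤ δ}^{(d−1)L^d + 1 − d} · ∫_{G^d} e^{−2N L^{d−2} b · S₁(a)} dHaar^{⊗d}(a)`,

`S₁(a) = wilsonAction ρ (L := 1) (fun e => a e.2) = Σ_{μ<ν} (N − Re tr ρ(a_μ a_ν a_μ⁻¹ a_ν⁻¹))` the ONE-SITE Wilson action (commutator cost).
Unlike the tree-gauge bound ✓`TorusTreeGauge.lintegral_boltzmann_ge_treeGauge` (ALL `(d−1)L^d + 1` off-comb links localised), the `d` AXIS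
WRAP LINKS `((L−1)e_μ, μ)` — whose gauge-fixed values are the based axis holonomies — are NOT localised: their law (Haar, by
✓`map_gaugeFixed_eq_pi`) is kept exactly and reappears as the one-site integral at temperature `2N L^{d−2} b`.  This is the lower half of
the holonomy-conditioned torus sandwich whose two halves have the SAME power of `b`, whence a `b`-UNIFORM torus doubling
`Z_L(b/2) ≤ e^{A L^d} Z_L(b)` (template ✓`…CUniformDoublingAll`) and the γ-uniform level-0 plaquette exponential moment.

§3–§4: the Gaussian radius `δ = (1+b)^{−1/2}` with the tree's small-ball bounds — ★`exists_lintegral_boltzmann_ge_axisHolonomy_gaussian`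
(every compact `G`, `D = dim 𝔤(ρ(G))`) and ★★`exists_lintegral_boltzmann_ge_axisHolonomy_SU` (`G = SU(N)`, fundamental, `D = N² − 1`).

PROOF.  §1 `lintegral_indicator_translate_pi_mul` (abstract): on `G^ι` with `ι = P ⊔ Pᶜ`, the integral of
`1{∀ j ∈ Pᶜ, c_j(x)⁻¹ W_j ∈ B}·f(x)` (`x` = the `P`-coordinates, centres `c_j(x)`) is `Haar(B)^{#Pᶜ}·∫ f` (`MeasurableEquiv.piEquivPiSubtypeProd`,
Tonelli, `Measure.pi_pi`, left invariance).  §2 the torus: comb-gauge push-forward (✓brick 1 `lintegral_boltzmann_eq_pi_gaugeFixed`), `P` = the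
axis links, centres = the hyperplane twist `Ū(a)` of the axis values (✓brick 2), on the event every link of the gauge-fixed field is `δ`-close
to `Ū(a)` so `S ≤ 2N·S(Ū(a)) + 16Nδ²#plaq ≤ 2N L^{d−2} S₁(a) + 16Nδ²#plaq` (✓`wilsonAction_le_of_near`, ✓`wilsonAction_twist_le`), and the
axis integral is re-indexed by `Fin d` (`MeasurableEquiv.piCongrLeft`).

HONEST SCOPE.  A lower bound on a partition function; nothing of LINE #13's stubs ∕ `HistoryTailL` ∕ any crux is proved.  YM₃ on T³ is rung
R3 — not d = 4, not infinite volume, not a mass gap, not Clay.  THEOREMS ONLY (0 `def`, 0 `sorry`); count-neutral. -/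

noncomputable section

open MeasureTheory Finset Function
open scoped ENNReal Matrix.Norms.L2Operator

namespace Summit.QuantumFields.YangMills.Theorems.LocalInsertion.TorusTreeGauge

open Literature.MathematicalPhysics.QuantumFieldTheory
open Literature.MathematicalPhysics.QuantumFieldTheory.AxialGauge
open Summit.QuantumFields.YangMills.Theorems.LocalInsertion.TorusTwist

/-! ## §1 Abstract: translated balls on a block of coordinates integrate to `Haar(B)^{#block}` -/

section Abstract

variable {ι : Type*} [Fintype ι] {G : Type*} [Group G] [MeasurableSpace G] [MeasurableMul₂ G] [MeasurableInv G]

/-- **Translated balls on a block of independent coordinates.**  On `G^ι` with product measure `μ₀^{⊗ι}` (`μ₀` a left-invariant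
probability measure), split `ι = {p} ⊔ {¬p}`; if the centres `c_j(x)` of the `¬p`-coordinates depend only on the `p`-coordinates `x`,
then `∫ 1{∀ j, c_j(x)⁻¹·W_j ∈ B}·f(x) dμ₀^{⊗ι}(W) = μ₀(B)^{#{¬p}} · ∫ f dμ₀^{⊗{p}}`. [folklore] -/
theorem lintegral_indicator_translate_pi_mul (p : ι → Prop) [DecidablePred p] (μ₀ : Measure G) [IsProbabilityMeasure μ₀]
    [μ₀.IsMulLeftInvariant] {B : Set G} (hB : MeasurableSet B)
    (ctr : ({i // p i} → G) → {i // ¬ p i} → G) (hctr : ∀ j, Measurable fun x => ctr x j)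
    {f : ({i // p i} → G) → ℝ≥0∞} (hf : Measurable f) :
    ∫⁻ W : ι → G, {W : ι → G | ∀ j : {i // ¬ p i}, (ctr (fun i => W i.1) j)⁻¹ * W j.1 ∈ B}.indicator 1 W *
        f (fun i => W i.1) ∂(Measure.pi fun _ : ι => μ₀) =
      μ₀ B ^ Fintype.card {i // ¬ p i} * ∫⁻ x, f x ∂(Measure.pi fun _ : {i // p i} => μ₀) := by
  classical
  set e := MeasurableEquiv.piEquivPiSubtypeProd (fun _ : ι => G) p with he
  set E : Set (ι → G) := {W : ι → G | ∀ j : {i // ¬ p i}, (ctr (fun i => W i.1) j)⁻¹ * W j.1 ∈ B} with hE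
  -- measurability of the integrand
  have hres : Measurable fun (W : ι → G) (i : {i // p i}) => W i.1 := measurable_pi_lambda _ fun i => measurable_pi_apply _
  have hEm : MeasurableSet E := by
    have : E = ⋂ j : {i // ¬ p i}, (fun W : ι → G => (ctr (fun i => W i.1) j)⁻¹ * W j.1) ⁻¹' B := by
      ext W; simp [hE]
    rw [this]
    exact MeasurableSet.iInter fun j => (((hctr j).comp hres).inv.mul (measurable_pi_apply _)) hB
  set Φ : (ι → G) → ℝ≥0∞ := fun W => E.indicator 1 W * f (fun i => W i.1) with hΦ
  have hΦm : Measurable Φ := (measurable_one.indicator hEm).mul (hf.comp hres)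
  -- transfer to the product of the two blocks
  have hmp := (measurePreserving_piEquivPiSubtypeProd (fun _ : ι => μ₀) p).symm e
  rw [show (∫⁻ W : ι → G, E.indicator 1 W * f (fun i => W i.1) ∂(Measure.pi fun _ : ι => μ₀)) =
      ∫⁻ W, Φ W ∂(Measure.pi fun _ : ι => μ₀) from rfl, ← hmp.lintegral_comp hΦm,
    lintegral_prod (fun z => Φ (e.symm z)) (hΦm.comp e.symm.measurable).aemeasurable]
  -- the integrand on the product: the translated box in `y`, times `f x`
  set S : ({i // p i} → G) → {i // ¬ p i} → Set G := fun x j => (fun g => (ctr x j)⁻¹ * g) ⁻¹' B with hS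
  have hSm : ∀ x j, MeasurableSet (S x j) := fun x j => (measurable_const.mul measurable_id) hB
  have hΦxy : ∀ (x : {i // p i} → G) (y : {i // ¬ p i} → G),
      Φ (e.symm (x, y)) = (Set.pi Set.univ (S x)).indicator 1 y * f x := by
    intro x y
    have hx : (fun i : {i // p i} => e.symm (x, y) i.1) = x := by
      funext i
      simp only [he, MeasurableEquiv.piEquivPiSubtypeProd_symm_apply]
      simp [i.2]
    have hy : ∀ j : {i // ¬ p i}, e.symm (x, y) j.1 = y j := by
      intro j
      simp only [he, MeasurableEquiv.piEquivPiSubtypeProd_symm_apply]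
      simp [j.2]
    have hmem : e.symm (x, y) ∈ E ↔ y ∈ Set.pi Set.univ (S x) := by
      rw [Set.mem_univ_pi]
      show (∀ j : {i // ¬ p i}, (ctr (fun i : {i // p i} => e.symm (x, y) i.1) j)⁻¹ * e.symm (x, y) j.1 ∈ B) ↔
        ∀ j, y j ∈ S x j
      rw [hx]
      exact forall_congr' fun j => by rw [hy j]; rfl
    simp only [hΦ, hx]
    congr 1
    by_cases hyS : y ∈ Set.pi Set.univ (S x)
    · rw [Set.indicator_of_mem hyS, Set.indicator_of_mem (hmem.2 hyS), Pi.one_apply, Pi.one_apply]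
    · rw [Set.indicator_of_notMem hyS, Set.indicator_of_notMem (fun h => hyS (hmem.1 h))]
  simp_rw [hΦxy]
  have hinner : ∀ x : {i // p i} → G,
      ∫⁻ y, (Set.pi Set.univ (S x)).indicator 1 y * f x ∂(Measure.pi fun _ : {i // ¬ p i} => μ₀) =
        μ₀ B ^ Fintype.card {i // ¬ p i} * f x := by
    intro x
    rw [lintegral_mul_const _ (measurable_one.indicator (MeasurableSet.univ_pi fun j => hSm x j)),
      lintegral_indicator_one (MeasurableSet.univ_pi fun j => hSm x j), Measure.pi_pi]
    congr 1
    rw [← Finset.card_univ, ← Finset.prod_const]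
    exact Finset.prod_congr rfl fun j _ => measure_preimage_mul μ₀ _ _
  simp_rw [hinner]
  rw [lintegral_const_mul _ hf]

end Abstract

/-! ## §2 The torus: axis links, the twist, and the lower bound -/

section Torus

variable {d L m : ℕ} [NeZero d] [NeZero L] [Fact (1 < L)] [NeZero m]
variable {G : Type*} [Group G] [TopologicalSpace G] [IsTopologicalGroup G] [CompactSpace G]
  [MeasurableSpace G] [BorelSpace G] [SecondCountableTopology G]
variable (ρ : G →* Matrix (Fin m) (Fin m) ℂ) (hρu : ∀ g, ρ g ∈ Matrix.unitaryGroup (Fin m) ℂ)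

omit [NeZero d] [Fact (1 < L)] in
/-- `((L−1 : ℕ) : ZMod L).val + 1 = L`. [folklore] -/
theorem val_pred_cast_add_one : (((L - 1 : ℕ) : ZMod L)).val + 1 = L := by
  have hL : 0 < L := Nat.pos_of_ne_zero (NeZero.ne L)
  rw [ZMod.val_natCast, Nat.mod_eq_of_lt (by omega)]; omega

omit [NeZero d] [Fact (1 < L)] in
/-- The axis wrap link `((L−1)e_μ, μ)` is NOT a comb edge. [folklore] -/
theorem axisEdge_not_comb (μ : Fin d) :
    ¬ ((∀ k : Fin d, μ < k → (Pi.single μ (((L - 1 : ℕ) : ZMod L)) : Site d L) k = 0) ∧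
      ((Pi.single μ (((L - 1 : ℕ) : ZMod L)) : Site d L) μ).val + 1 < L) := by
  rintro ⟨-, h⟩
  rw [Pi.single_eq_same, val_pred_cast_add_one] at h
  exact lt_irrefl _ h

include hρu in
/-- ★ **THE HOLONOMY-CONDITIONED GAUSSIAN LOWER BOUND (every `d`).**  For `b, δ ≥ 0`:
`∫ e^{−bS} dπ ≥ e^{−16Nbδ²·#plaquettes} · Haar{‖ρ g − 1‖ ≤ δ}^{(d−1)L^d + 1 − d} · ∫_{G^d} e^{−2N L^{d−2} b·S₁(a)} dHaar^{⊗d}(a)`,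
`S₁` the one-site Wilson action (commutator cost). [cite: Chatterjee2016, Lemma 9.3; Balaban1987RG1, (0.15) p.254] -/
theorem lintegral_boltzmann_ge_axisHolonomy (hρc : Continuous ρ) {b δ : ℝ} (hb : 0 ≤ b) (hδ : 0 ≤ δ) :
    ENNReal.ofReal (Real.exp (-(16 * m * b * δ ^ 2 * Fintype.card (Plaquette d L)))) *
        (haarProbability G {g : G | ‖ρ g - 1‖ ≤ δ}) ^ ((d - 1) * L ^ d + 1 - d) *
        ∫⁻ a : Fin d → G, ENNReal.ofReal (Real.exp (-(2 * m * (L : ℝ) ^ (d - 2) * b) *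
            wilsonAction ρ (fun e : Edge d 1 => a e.2))) ∂(Measure.pi fun _ : Fin d => haarProbability G) ≤
      ∫⁻ U, ENNReal.ofReal (Real.exp (-b * wilsonAction ρ U)) ∂(Measure.pi fun _ : Edge d L => haarProbability G) := by
  classical
  set tc : Edge d L → Prop := fun e => (∀ k : Fin d, e.2 < k → e.1 k = 0) ∧ (e.1 e.2).val + 1 < L with htc
  set F : Finset (Edge d L) := (Finset.univ : Finset (Edge d L)).filter fun e => ¬ tc e with hF
  set Ball : Set G := {g : G | ‖ρ g - 1‖ ≤ δ} with hBall
  have hBallm : MeasurableSet Ball := (isClosed_le ((hρc.sub continuous_const).norm) continuous_const).measurableSet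
  -- the axis links
  set cL : ZMod L := ((L - 1 : ℕ) : ZMod L) with hcL
  set Ax : Fin d → Edge d L := fun μ => ((Pi.single μ cL : Site d L), μ) with hAx
  have hAxF : ∀ μ, Ax μ ∈ F := fun μ => Finset.mem_filter.2 ⟨Finset.mem_univ _, axisEdge_not_comb (L := L) μ⟩
  let p : ↥F → Prop := fun i => ∃ μ, Ax μ = i.1
  -- `Fin d ≃ {i // p i}`
  have hAx2 : ∀ μ, (Ax μ).2 = μ := fun μ => rfl
  set eA : Fin d ≃ {i : ↥F // p i} :=
    { toFun := fun μ => ⟨⟨Ax μ, hAxF μ⟩, μ, rfl⟩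
      invFun := fun i => i.1.1.2
      left_inv := fun μ => rfl
      right_inv := fun i => by
        obtain ⟨⟨e, he⟩, μ, hμ⟩ := i
        apply Subtype.ext; apply Subtype.ext
        have hμ' : Ax μ = e := hμ
        show Ax e.2 = e
        rw [← hμ'] } with heA
  have hcard_p : Fintype.card {i : ↥F // p i} = d := by
    rw [← Fintype.card_congr eA, Fintype.card_fin]
  have hcard_np : Fintype.card {i : ↥F // ¬ p i} = (d - 1) * L ^ d + 1 - d := by
    rw [Fintype.card_subtype_compl, hcard_p, Fintype.card_coe, hF, card_filter_not_torusComb]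
  -- twist of the axis values and the centres of the inner links
  set tw : (Fin d → G) → GaugeConfig d L G := fun a e => if (e.1 e.2).val + 1 = L then a e.2 else 1 with htw
  set ctr : ({i : ↥F // p i} → G) → {i : ↥F // ¬ p i} → G := fun x j => tw (fun μ => x (eA μ)) j.1.1 with hctr
  have hctrm : ∀ j, Measurable fun x => ctr x j := by
    intro j
    simp only [hctr, htw]
    by_cases h : (j.1.1.1 j.1.1.2).val + 1 = L
    · simp only [if_pos h]; exact measurable_pi_apply _
    · simp only [if_neg h]; exact measurable_const
  -- the one-site weight as a function of the axis block
  set g₁ : (Fin d → G) → ℝ≥0∞ := fun a => ENNReal.ofReal (Real.exp (-(2 * m * (L : ℝ) ^ (d - 2) * b) *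
      wilsonAction ρ (fun e : Edge d 1 => a e.2))) with hg₁
  have hg₁m : Measurable g₁ := by
    refine ENNReal.measurable_ofReal.comp (Real.measurable_exp.comp (Measurable.const_mul ?_ _))
    exact (measurable_wilsonAction ρ hρc).comp (measurable_pi_lambda _ fun e => measurable_pi_apply _)
  have hproj : Measurable (fun (x : {i : ↥F // p i} → G) (μ : Fin d) => x (eA μ)) :=
    measurable_pi_lambda _ (fun μ => measurable_pi_apply (eA μ))
  -- (the composition is kept folded: unfolding it against `g₁` is a defeq trap)
  have hfm : Measurable (g₁ ∘ fun (x : {i : ↥F // p i} → G) (μ : Fin d) => x (eA μ)) := hg₁m.comp hproj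
  -- Step 1: the comb gauge
  rw [lintegral_boltzmann_eq_pi_gaugeFixed ρ hρc b]
  -- Step 2: pointwise lower bound on `G^{E_free}`
  set c₀ : ℝ≥0∞ := ENNReal.ofReal (Real.exp (-(16 * m * b * δ ^ 2 * Fintype.card (Plaquette d L)))) with hc₀
  have hpt : ∀ W : ↥F → G,
      c₀ * ({W : ↥F → G | ∀ j : {i : ↥F // ¬ p i}, (ctr (fun i => W i.1) j)⁻¹ * W j.1 ∈ Ball}.indicator 1 W *
          (g₁ ∘ fun (x : {i : ↥F // p i} → G) (μ : Fin d) => x (eA μ)) (fun i => W i.1)) ≤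
        ENNReal.ofReal (Real.exp (-b * wilsonAction ρ (Function.extend (Subtype.val : ↥F → Edge d L) W 1))) := by
    intro W
    by_cases hW : W ∈ {W : ↥F → G | ∀ j : {i : ↥F // ¬ p i}, (ctr (fun i => W i.1) j)⁻¹ * W j.1 ∈ Ball}
    · rw [Set.indicator_of_mem hW, Pi.one_apply, one_mul, Function.comp_apply, hc₀, hg₁]
      simp only
      rw [← ENNReal.ofReal_mul (Real.exp_pos _).le, ← Real.exp_add]
      refine ENNReal.ofReal_le_ofReal (Real.exp_le_exp.mpr ?_)
      -- every link of `extend W 1` is `δ`-close to the twist of the axis values `a`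
      set a : Fin d → G := fun μ => W (eA μ).1 with ha
      have hnear : ∀ e : Edge d L, ‖ρ (Function.extend (Subtype.val : ↥F → Edge d L) W 1 e) - ρ (tw a e)‖ ≤ δ := by
        intro e
        by_cases he : e ∈ F
        · rw [Subtype.val_injective.extend_apply _ _ ⟨e, he⟩]
          by_cases hpe : p ⟨e, he⟩
          · -- an axis link: both sides are `a_μ`
            obtain ⟨μ, hμ⟩ := hpe
            have hμ' : Ax μ = e := hμ
            subst hμ'
            have hcond : ((Ax μ).1 (Ax μ).2).val + 1 = L := by
              show ((Pi.single μ cL : Site d L) μ).val + 1 = L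
              rw [Pi.single_eq_same]; exact val_pred_cast_add_one
            have htwe : tw a (Ax μ) = a μ := by
              show (if ((Ax μ).1 (Ax μ).2).val + 1 = L then a (Ax μ).2 else 1) = a μ
              rw [if_pos hcond]
            have hWa : W ⟨Ax μ, he⟩ = a μ := rfl
            rw [htwe, hWa, sub_self, norm_zero]
            exact hδ
          · -- an inner link: the event
            have hj := hW ⟨⟨e, he⟩, hpe⟩
            have hctr_eq : ctr (fun i => W i.1) ⟨⟨e, he⟩, hpe⟩ = tw a e := rfl
            rw [hctr_eq] at hj
            exact (norm_rep_sub_rep_le ρ hρu _ _).trans hj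
        · -- a comb link: both sides are `1`
          have hnot : ¬ ∃ i : ↥F, (Subtype.val i) = e := by rintro ⟨i, rfl⟩; exact he i.2
          rw [Function.extend_apply' _ _ _ hnot, Pi.one_apply]
          have htc_e : tc e := by
            by_contra h; exact he (Finset.mem_filter.2 ⟨Finset.mem_univ _, h⟩)
          have htwe : tw a e = 1 := by
            show (if (e.1 e.2).val + 1 = L then a e.2 else 1) = 1
            rw [if_neg (ne_of_lt htc_e.2)]
          rw [htwe, sub_self, norm_zero]; exact hδ
      have h1 := wilsonAction_le_of_near ρ hρu hnear
      have h2 := wilsonAction_twist_le (L := L) ρ hρu a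
      have hm : (0 : ℝ) ≤ 2 * m := by positivity
      have h3 : 2 * (m : ℝ) * wilsonAction ρ (tw a) ≤ 2 * m * ((L : ℝ) ^ (d - 2) * wilsonAction ρ (fun e : Edge d 1 => a e.2)) :=
        mul_le_mul_of_nonneg_left h2 hm
      show -(16 * (m : ℝ) * b * δ ^ 2 * (Fintype.card (Plaquette d L) : ℝ)) +
          (-(2 * (m : ℝ) * (L : ℝ) ^ (d - 2) * b) * wilsonAction ρ (fun e : Edge d 1 => a e.2)) ≤
        -b * wilsonAction ρ (Function.extend (Subtype.val : ↥F → Edge d L) W 1)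
      nlinarith
    · rw [Set.indicator_of_notMem hW, zero_mul, mul_zero]; exact bot_le
  -- Step 3: integrate the lower bound
  have key := lintegral_indicator_translate_pi_mul p (haarProbability G) hBallm ctr hctrm hfm
  calc c₀ * (haarProbability G) Ball ^ ((d - 1) * L ^ d + 1 - d) *
        ∫⁻ a : Fin d → G, g₁ a ∂(Measure.pi fun _ : Fin d => haarProbability G)
      = c₀ * ((haarProbability G) Ball ^ Fintype.card {i : ↥F // ¬ p i} *
          ∫⁻ x, (g₁ ∘ fun (x : {i : ↥F // p i} → G) (μ : Fin d) => x (eA μ)) x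
            ∂(Measure.pi fun _ : {i : ↥F // p i} => haarProbability G)) := by
        rw [hcard_np, mul_assoc]
        congr 2
        -- re-index the axis block by `Fin d`
        have hmp := measurePreserving_piCongrLeft (fun _ : {i : ↥F // p i} => haarProbability G) eA
        -- (`rw` closes the goal by `rfl`: `(piCongrLeft eA a) (eA μ) ≡ a (eA.symm (eA μ)) ≡ a μ` since `eA.left_inv μ` is `rfl`)
        rw [← hmp.lintegral_comp hfm]
        refine lintegral_congr fun a => ?_
        simp only [Function.comp, MeasurableEquiv.piCongrLeft_apply_apply]
    _ = c₀ * ∫⁻ W : ↥F → G, {W : ↥F → G | ∀ j : {i : ↥F // ¬ p i}, (ctr (fun i => W i.1) j)⁻¹ * W j.1 ∈ Ball}.indicator 1 W *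
          (g₁ ∘ fun (x : {i : ↥F // p i} → G) (μ : Fin d) => x (eA μ)) (fun i => W i.1)
            ∂(Measure.pi fun _ : ↥F => haarProbability G) := by
        rw [← key]
    _ = ∫⁻ W : ↥F → G, c₀ * ({W : ↥F → G | ∀ j : {i : ↥F // ¬ p i}, (ctr (fun i => W i.1) j)⁻¹ * W j.1 ∈ Ball}.indicator 1 W *
          (g₁ ∘ fun (x : {i : ↥F // p i} → G) (μ : Fin d) => x (eA μ)) (fun i => W i.1))
            ∂(Measure.pi fun _ : ↥F => haarProbability G) := by
        rw [lintegral_const_mul' _ _ ENNReal.ofReal_ne_top]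
    _ ≤ _ := lintegral_mono fun W => hpt W

end Torus

/-! ## §3 Gaussian radius `δ = (1+b)^{−1/2}` and the small-ball bound -/

section Gaussian

variable {d L m : ℕ} [NeZero d] [NeZero L] [Fact (1 < L)] [NeZero m]
variable {G : Type*} [Group G] [TopologicalSpace G] [IsTopologicalGroup G] [CompactSpace G]
  [MeasurableSpace G] [BorelSpace G] [SecondCountableTopology G]
variable (ρ : G →* Matrix (Fin m) (Fin m) ℂ) (hρu : ∀ g, ρ g ∈ Matrix.unitaryGroup (Fin m) ℂ)

include hρu in
/-- ★ **THE HOLONOMY-CONDITIONED LOWER BOUND, GAUSSIAN FORM, every compact `G`** (`δ = (1+b)^{−1/2}`, `bδ² ≤ 1`, small-ball bound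
✓`haar_ball_ge_of_unitaryRep` with `D = dim_ℝ 𝔤(ρ(G))`): there is `c ∈ (0,1]` with, for all `L ≥ 2`, `b ≥ 0`,
`∫ e^{−bS} dπ ≥ e^{−16N d² L^d} · (c·(√(1+b))⁻¹^D)^{(d−1)L^d+1−d} · ∫_{G^d} e^{−2N L^{d−2} b·S₁(a)} dHaar^{⊗d}(a)`.
[cite: Chatterjee2016, Lemma 9.3; Balaban1987RG1, (0.15) p.254] -/
theorem exists_lintegral_boltzmann_ge_axisHolonomy_gaussian (hρc : Continuous ρ) :
    ∃ c : ℝ, 0 < c ∧ c ≤ 1 ∧ ∀ (L : ℕ) [NeZero L] [Fact (1 < L)] (b : ℝ), 0 ≤ b →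
      ENNReal.ofReal (Real.exp (-(16 * (m : ℝ) * d ^ 2 * (L : ℝ) ^ d))) *
          ENNReal.ofReal ((c * (Real.sqrt (1 + b))⁻¹ ^ Module.finrank ℝ
              (Literature.MathematicalPhysics.QuantumLattice.matrixLieAlgebra (Set.range ρ))) ^ ((d - 1) * L ^ d + 1 - d)) *
          ∫⁻ a : Fin d → G, ENNReal.ofReal (Real.exp (-(2 * m * (L : ℝ) ^ (d - 2) * b) *
              wilsonAction ρ (fun e : Edge d 1 => a e.2))) ∂(Measure.pi fun _ : Fin d => haarProbability G) ≤
        ∫⁻ U, ENNReal.ofReal (Real.exp (-b * wilsonAction ρ U)) ∂(Measure.pi fun _ : Edge d L => haarProbability G) := by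
  obtain ⟨c, hc, hc1, hball⟩ :=
    Balaban1983to89.HaarSmallBallClosedSubgroup.haar_ball_ge_of_unitaryRep ρ hρc hρu (R := 1) one_pos
  refine ⟨c, hc, hc1, fun L _ _ b hb => ?_⟩
  set D : ℕ := Module.finrank ℝ (Literature.MathematicalPhysics.QuantumLattice.matrixLieAlgebra (Set.range ρ)) with hD
  set s : ℝ := Real.sqrt (1 + b) with hs
  have hs1 : 1 ≤ s := by rw [hs]; exact Real.one_le_sqrt.mpr (by linarith)
  have hs0 : 0 < s := one_pos.trans_le hs1
  set r : ℝ := s⁻¹ with hr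
  have hr0 : 0 < r := inv_pos.mpr hs0
  have hr1 : r ≤ 1 := inv_le_one_of_one_le₀ hs1
  have hbr : b * r ^ 2 ≤ 1 := by
    rw [hr, inv_pow, hs, Real.sq_sqrt (by linarith), mul_inv_le_iff₀ (by linarith)]
    linarith
  haveI : (haarProbability G).IsMulLeftInvariant := by unfold haarProbability; infer_instance
  have hb' := hball (haarProbability G) r hr0 hr1
  have key := lintegral_boltzmann_ge_axisHolonomy (d := d) (L := L) ρ hρu hρc hb hr0.le
  refine le_trans ?_ key
  gcongr ?_ * ?_ * _
  · refine ENNReal.ofReal_le_ofReal (Real.exp_le_exp.mpr (neg_le_neg ?_))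
    have hP : (Fintype.card (Plaquette d L) : ℝ) ≤ d ^ 2 * (L : ℝ) ^ d := by exact_mod_cast LatticeForm.card_plaquette_le
    calc 16 * (m : ℝ) * b * r ^ 2 * Fintype.card (Plaquette d L)
        = (b * r ^ 2) * (16 * m) * Fintype.card (Plaquette d L) := by ring
      _ ≤ 1 * (16 * m) * (d ^ 2 * (L : ℝ) ^ d) := by gcongr
      _ = 16 * (m : ℝ) * d ^ 2 * (L : ℝ) ^ d := by ring
  · rw [ENNReal.ofReal_pow (mul_pos hc (pow_pos hr0 _)).le]
    exact pow_le_pow_left' hb' _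

end Gaussian

/-! ## §4 `G = SU(N)`: exponent `N² − 1` -/

section SpecialUnitary

open Literature.MathematicalPhysics.QuantumLattice (fundamentalRep continuous_fundamentalRep fundamentalRep_mem_unitaryGroup)
open Balaban1983to89.HaarSmallBallClosedSubgroup (haar_ball_ge_specialUnitaryGroup)

variable {d N : ℕ} [NeZero d] [NeZero N]

/-- ★★ **THE HOLONOMY-CONDITIONED LOWER BOUND FOR `SU(N)` (fundamental Wilson action), GAUSSIAN FORM**: there is `c ∈ (0,1]` with, on
every torus `(ℤ/Lℤ)^d` (`L ≥ 2`) and every `b ≥ 0`,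
`∫ e^{−bS} dπ ≥ e^{−16N d² L^d} · (c·(√(1+b))⁻¹^{N²−1})^{(d−1)L^d+1−d} · ∫_{SU(N)^d} e^{−2N L^{d−2} b·S₁(a)} dHaar^{⊗d}(a)` — `d = 3`, `N = 2`:
exponent `3·(2L³ − 2)`, one-site temperature `4Lb`. [cite: Chatterjee2016, Lemma 9.3, Lemma 17.6; Balaban1987RG1, (0.15) p.254] -/
theorem exists_lintegral_boltzmann_ge_axisHolonomy_SU :
    ∃ c : ℝ, 0 < c ∧ c ≤ 1 ∧ ∀ (L : ℕ) [NeZero L] [Fact (1 < L)] (b : ℝ), 0 ≤ b →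
      ENNReal.ofReal (Real.exp (-(16 * (N : ℝ) * d ^ 2 * (L : ℝ) ^ d))) *
          ENNReal.ofReal ((c * (Real.sqrt (1 + b))⁻¹ ^ (N ^ 2 - 1)) ^ ((d - 1) * L ^ d + 1 - d)) *
          ∫⁻ a : Fin d → Matrix.specialUnitaryGroup (Fin N) ℂ, ENNReal.ofReal (Real.exp (-(2 * N * (L : ℝ) ^ (d - 2) * b) *
              wilsonAction (fundamentalRep (Fin N)) (fun e : Edge d 1 => a e.2)))
            ∂(Measure.pi fun _ : Fin d => haarProbability (Matrix.specialUnitaryGroup (Fin N) ℂ)) ≤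
        ∫⁻ U, ENNReal.ofReal (Real.exp (-b * wilsonAction (fundamentalRep (Fin N)) U))
          ∂(Measure.pi fun _ : Edge d L => haarProbability (Matrix.specialUnitaryGroup (Fin N) ℂ)) := by
  haveI := Literature.Barriers.QuantumFields.secondCountableTopology_su N
  obtain ⟨c, hc, hc1, hball⟩ := haar_ball_ge_specialUnitaryGroup (n := Fin N) (R := 1) one_pos
  refine ⟨c, hc, hc1, fun L _ _ b hb => ?_⟩
  set s : ℝ := Real.sqrt (1 + b) with hs
  have hs1 : 1 ≤ s := by rw [hs]; exact Real.one_le_sqrt.mpr (by linarith)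
  have hs0 : 0 < s := one_pos.trans_le hs1
  set r : ℝ := s⁻¹ with hr
  have hr0 : 0 < r := inv_pos.mpr hs0
  have hr1 : r ≤ 1 := inv_le_one_of_one_le₀ hs1
  have hbr : b * r ^ 2 ≤ 1 := by
    rw [hr, inv_pow, hs, Real.sq_sqrt (by linarith), mul_inv_le_iff₀ (by linarith)]
    linarith
  haveI : (haarProbability (Matrix.specialUnitaryGroup (Fin N) ℂ)).IsMulLeftInvariant := by
    unfold haarProbability; infer_instance
  have hb' := hball (haarProbability (Matrix.specialUnitaryGroup (Fin N) ℂ)) r hr0 hr1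
  rw [Fintype.card_fin] at hb'
  have hball' : ENNReal.ofReal (c * r ^ (N ^ 2 - 1)) ≤
      haarProbability (Matrix.specialUnitaryGroup (Fin N) ℂ) {g | ‖fundamentalRep (Fin N) g - 1‖ ≤ r} := by
    simpa only [Literature.MathematicalPhysics.QuantumLattice.fundamentalRep_apply] using hb'
  have key := lintegral_boltzmann_ge_axisHolonomy (d := d) (L := L) (fundamentalRep (Fin N)) fundamentalRep_mem_unitaryGroup
    (continuous_fundamentalRep (Fin N)) hb hr0.le
  refine le_trans ?_ key
  gcongr ?_ * ?_ * _
  · refine ENNReal.ofReal_le_ofReal (Real.exp_le_exp.mpr (neg_le_neg ?_))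
    have hP : (Fintype.card (Plaquette d L) : ℝ) ≤ d ^ 2 * (L : ℝ) ^ d := by exact_mod_cast LatticeForm.card_plaquette_le
    calc 16 * (N : ℝ) * b * r ^ 2 * Fintype.card (Plaquette d L)
        = (b * r ^ 2) * (16 * N) * Fintype.card (Plaquette d L) := by ring
      _ ≤ 1 * (16 * N) * (d ^ 2 * (L : ℝ) ^ d) := by gcongr
      _ = 16 * (N : ℝ) * d ^ 2 * (L : ℝ) ^ d := by ring
  · rw [ENNReal.ofReal_pow (mul_pos hc (pow_pos hr0 _)).le]
    exact pow_le_pow_left' hball' _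

end SpecialUnitary

end Summit.QuantumFields.YangMills.Theorems.LocalInsertion.TorusTreeGauge

end
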